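import Summits.BirchSwinnertonDyer.Rank1Residual.GaloisImage.PadicRootCensusRoots
import Mathlib.NumberTheory.Padics.RingHoms
import HarnessLib

/-!
# Root census v3: the residue tree with a CHILD SIEVE mod `p` (reduced scaled Taylor polynomial) and
# the Taylor exclusion test at deep valuation — n1011's `RootCensus.check₂` made affordable at large
# `p` and high degree (cell `b2b-bsdres`, supersingular family, prover A = unit `b2b-bsdres-x10b`,
# gen 23 — TOOL, pure `p`-adic algebra; sequel of `GaloisImage/PadicRootCensusTaylor` /
# `PadicRootCensusRoots`)

HONEST FRAMING (cell `b2b-bsdres`, run/shared/lean/b2b/bsd-rank1-residual/, verbatim in every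
file): the goal of the cell is to DELETE the COMBINATION-SHAPED residual classes of the
Birch–Swinnerton-Dyer formula for ALL analytic-rank `≤ 1` elliptic curves over `ℚ` — "full BSD
formula for every rank `≤ 1` curve in class `C`" assembled STRICTLY from published theorems — so
that the rank-`≤ 1` remainder becomes exactly the CONSTRUCTION-SHAPED classes, which are TYPED
(missing-input `Prop`s), NOT attempted. This is not "finishing BSD". This file is a TOOL; nothing is
booked by it; no mark / label / count moved. No named fact, no `sorry`; the only definitions are
COMPUTABLE bookkeeping (integer lists and the Boolean checker `check₃` with its parts).

## Why a third checker

FILE A1b's tree search `check₂` expands an alive class `r (mod p^j)` into ALL `p` children and runs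
the Taylor exclusion test `dead` (a full Taylor shift, `O(deg²)` big-integer products, plus powers of
`p`) on each, and `dead` reads `v_p(F(r))` with `valFuel p 64`. For the degree-`12` / `24` division
polynomials `ψ₅`, `ψ₇` of the supersingular family's local torsion decider
(`Supersingular/LocalOddTorsionDeciderAt`) this is unaffordable in the kernel exactly where the
visibility partners live: at a multiplicative place with `5 ∣ v_ℓ(Δ)` the abscissae
`x(q^{1/5}), x(q^{2/5})` are roots in `ℤ_ℓ` with `v_ℓ(ψ₅') = 9, 13`, so Hensel balls absorb only from
level `10`, `14` on, and e.g. at `ℓ = 587` (the partner of 430882i1) `check₂` needs `≈ 13 000`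
exclusion tests — the kernel runs out of memory (x10b gen 23, measured); and at `ℓ ∈ {2, 3}`,
`v_ℓ(Δ) ≈ 20`, `v_ℓ(ψ₅(r))` passes `64` from level `≈ 12` on, the capped test never fires and the
tree grows like `ℓ^j`. Both cures are bookkeeping:

* CHILD SIEVE. For an alive class `r (mod p^j)` write `F(r + p^j t) = Σ sᵢ tⁱ`, `sᵢ = cᵢ p^{ij}`
  (`cᵢ` the integer Taylor coefficients at `r`), `s = p^{v₀} d` with `d` integral (`v₀` read off
  `gcd(s)`), `ḡ = d mod p`. If `z = r + p^j t' ∈ ℤ_p` is a root then `Σ dᵢ t'ⁱ = 0`, so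
  `ḡ(t' mod p) = 0`: the child digit `t` of any root satisfies `p ∣ ḡ(t)` (`dvd_evalList_of_root`). Only
  those `≤ deg F` digits are expanded (`childDigits`); the other `p − deg F` children cost one
  evaluation of `ḡ` over integers `< p` each.
* DEEP FUEL. `deadDeep` = `dead` with `valFuel p (64·(|l|+1))`.

## What

`scaleList`, `sieveList`, `childDigits`, `deadDeep`, `alive₃`, `frontierStep₃`, `coverTree₃`,
`coverOK₃`, `check₃` (definitions) and the soundness chain `aeval_ofList_scaleList`,
`dvd_evalList_of_root`, `mem_childDigits_of_root`, `aeval_ne_zero_of_deadDeep`, `inBall_of_coverTree₃`,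
`inBall_of_coverOK₃`, **`exists_roots_of_check₃`** — the census theorem in exactly the shape of FILE
A2's `exists_roots_of_check₂` (via its generic core `exists_roots_of_cover`).

References: standard (Hensel's lemma, Mathlib; residue-class sieving for `p`-adic root isolation).
-/

set_option autoImplicit false

open Polynomial
open Summit.BirchSwinnertonDyer.Rank1Residual.GaloisImage.RootCensus

namespace Summit.BirchSwinnertonDyer.Rank1Residual.Supersingular.RootCensusSieve

/-! ### §1 The child sieve: definitions -/

/-- Scaled coefficient list: from `[c_d, c_{d+1}, …]` to `[c_d p^{dj}, c_{d+1} p^{(d+1)j}, …]`. [folklore] -/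
def scaleList (p : ℕ) (j : ℕ) : ℕ → List ℤ → List ℤ
  | _, [] => []
  | d, c :: cs => c * (p : ℤ) ^ (d * j) :: scaleList p j (d + 1) cs

/-- The reduced sieve polynomial `ḡ` of the class `r (mod p^j)`: with `s = scaleList p j 0 (taylorList l r)`
(so `F(r + p^j t) = Σ sᵢ tⁱ`) and `v₀ = valFuel (gcd s)`: if `p^{v₀}` divides every `sᵢ`, the list
`[(sᵢ / p^{v₀}) mod p]`; otherwise `none` (no sieve). [folklore] -/
def sieveList (p : ℕ) (l : List ℤ) (j : ℕ) (r : ℤ) : Option (List ℤ) :=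
  let s := scaleList p j 0 (taylorList l r)
  let v₀ := valFuel p (64 * (l.length + 1) * (j + 1)) (s.foldl (fun a b => (Int.gcd a b : ℤ)) 0)
  if s.all (fun c => c % ((p : ℤ) ^ v₀) == 0)
  then some (s.map fun c => c / (p : ℤ) ^ v₀ % (p : ℤ))
  else none

/-- The child digits of the class `r (mod p^j)` that may still contain a root of `F`: the `t < p` with
`p ∣ ḡ(t)` (all `t < p` if there is no sieve). [folklore] -/
def childDigits (p : ℕ) (l : List ℤ) (j : ℕ) (r : ℤ) : List ℕ :=
  match sieveList p l j r with
  | none => List.range p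
  | some ds => (List.range p).filter fun t : ℕ => evalList ds (t : ℤ) % (p : ℤ) == 0

/-! ### §2 The deep exclusion test and the v3 checker: definitions -/

/-- **The Taylor exclusion test, deep version** for the class `r + p^j ℤ_p`: as `RootCensus.dead` but
the valuation of the constant Taylor coefficient is read with fuel `64·(|l| + 1)`. [folklore] -/
def deadDeep (p : ℕ) (l : List ℤ) (j : ℕ) (r : ℤ) : Bool :=
  match taylorList l r with
  | [] => false
  | c₀ :: cs =>
    let e := valFuel p (64 * (l.length + 1)) c₀
    decide (c₀ ≠ 0) && !(c₀ % ((p : ℤ) ^ (e + 1)) == 0) && tailOK p e j 1 cs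

/-- ALIVE (v3): `F(r) ≡ 0 (mod p^j)`, not excluded by the deep Taylor test, in no certified ball.
[folklore] -/
def alive₃ (p : ℕ) (l : List ℤ) (cert : List (ℤ × ℕ × ℕ)) (j : ℕ) (r : ℤ) : Bool :=
  (evalList l r % ((p : ℤ) ^ j) == 0) && !(deadDeep p l j r) && !(inBall p cert j r)

/-- One level of the v3 residue tree: only the SIEVED children of each alive class are tested.
[folklore] -/
def frontierStep₃ (p : ℕ) (l : List ℤ) (cert : List (ℤ × ℕ × ℕ)) (j : ℕ) (fr : List ℤ) :
    List ℤ :=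
  fr.flatMap fun r =>
    ((childDigits p l j r).map fun t : ℕ => r + (t : ℤ) * (p : ℤ) ^ j).filter
      (alive₃ p l cert (j + 1))

/-- The v3 tree search. [folklore] -/
def coverTree₃ (p : ℕ) (l : List ℤ) (cert : List (ℤ × ℕ × ℕ)) : ℕ → ℕ → List ℤ → Bool
  | 0, _, fr => fr.isEmpty
  | fuel + 1, j, fr => fr.isEmpty || coverTree₃ p l cert fuel (j + 1) (frontierStep₃ p l cert j fr)

/-- The v3 residue check. [folklore] -/
def coverOK₃ (p : ℕ) (l : List ℤ) (k : ℕ) (cert : List (ℤ × ℕ × ℕ)) : Bool :=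
  coverTree₃ p l cert k 0 [0]

/-- **The v3 root-census checker** (entries + disjointness as in `check` / `check₂`; sieved residue
search with the deep Taylor exclusion test). [folklore] -/
def check₃ (p : ℕ) (l : List ℤ) (k : ℕ) (cert : List (ℤ × ℕ × ℕ)) : Bool :=
  cert.all (entryOK p l k) && pairwiseOK p cert && coverOK₃ p l k cert

variable {p : ℕ} [hp : Fact p.Prime]

/-! ### §3 Soundness of the child sieve -/

omit hp in
/-- `Σ (cᵢ p^{ij}) tⁱ` over the scaled list from degree `d` is `(p^j)^d · Σ cᵢ (p^j t)ⁱ`. [folklore] -/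
theorem aeval_ofList_scaleList {A : Type*} [CommRing A] [Algebra ℤ A] (j : ℕ) (t : A) :
    ∀ (d : ℕ) (cs : List ℤ), aeval t (ofList (scaleList p j d cs)) =
      ((p : A) ^ j) ^ d * aeval ((p : A) ^ j * t) (ofList cs)
  | d, [] => by simp [scaleList]
  | d, c :: cs => by
    rw [scaleList, aeval_ofList_cons, aeval_ofList_cons, aeval_ofList_scaleList j t (d + 1) cs]
    push_cast
    ring

/-- A list all of whose entries are divisible by `q` is `q` times the list of quotients, as
polynomials. [folklore] -/
theorem ofList_eq_C_mul_of_all_dvd (q : ℤ) :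
    ∀ s : List ℤ, (∀ c ∈ s, q ∣ c) → ofList s = C q * ofList (s.map fun c => c / q)
  | [], _ => by simp [ofList]
  | c :: s, h => by
    have hc : q ∣ c := h c (by simp)
    have ih := ofList_eq_C_mul_of_all_dvd q s fun c' hc' => h c' (by simp [hc'])
    rw [List.map_cons, ofList, ofList, ih]
    have : (C c : ℤ[X]) = C q * C (c / q) := by rw [← C_mul, Int.mul_ediv_cancel' hc]
    rw [this]; ring

/-- Reducing the coefficients mod `m` does not change the value mod `m`. [folklore] -/
theorem evalList_map_emod (m x : ℤ) :
    ∀ l : List ℤ, evalList (l.map fun c => c % m) x % m = evalList l x % m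
  | [] => by simp [evalList]
  | c :: l => by
    have ih := evalList_map_emod m x l
    simp only [List.map_cons, evalList]
    rw [Int.add_emod, Int.emod_emod_of_dvd _ (dvd_refl m), Int.mul_emod, ih, ← Int.mul_emod,
      ← Int.add_emod]

/-- A ring homomorphism out of `ℤ_p` commutes with the evaluation of an integer list polynomial. [folklore] -/
theorem map_aeval_ofList {B : Type*} [CommRing B] (f : ℤ_[p] →+* B) (x : ℤ_[p]) :
    ∀ l : List ℤ, f (aeval x (ofList l)) = aeval (f x) (ofList l)
  | [] => by simp
  | c :: l => by
    rw [aeval_ofList_cons, aeval_ofList_cons, map_add, map_mul, map_intCast, map_aeval_ofList f x l]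

/-- At an integer point the `ZMod p`-valued evaluation is the cast of the integer evaluation. [folklore] -/
theorem aeval_intCast_zmod_ofList (l : List ℤ) (c : ℤ) :
    aeval ((c : ℤ) : ZMod p) (ofList l) = ((evalList l c : ℤ) : ZMod p) := by
  have h := aeval_algebraMap_apply_eq_algebraMap_eval (A := ZMod p) c (ofList l)
  rw [eval_ofList] at h
  simpa using h

/-- **Soundness of the child sieve.** If `sieveList p l j r = some ds` and `z ∈ ℤ_p` is a root of
`F = ofList l` in the class of `r (mod p^j)` whose digit at level `j` is `t` (i.e.
`‖z − (r + t p^j)‖ ≤ p^{-(j+1)}`), then `p ∣ ḡ(t) = evalList ds t`. [folklore] -/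
theorem dvd_evalList_of_root {l : List ℤ} {j : ℕ} {r : ℤ} {ds : List ℤ}
    (hs : sieveList p l j r = some ds) {z : ℤ_[p]} (hz0 : aeval z (ofList l) = 0)
    (hzr : ‖z - (r : ℤ_[p])‖ ≤ (p : ℝ) ^ (-(j : ℤ))) {t : ℤ}
    (hzt : ‖z - ((r + t * (p : ℤ) ^ j : ℤ) : ℤ_[p])‖ ≤ (p : ℝ) ^ (-((j + 1 : ℕ) : ℤ))) :
    (p : ℤ) ∣ evalList ds t := by
  -- unpack the sieve
  unfold sieveList at hs
  simp only at hs
  split_ifs at hs with hall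
  simp only [Option.some.injEq] at hs
  set s := scaleList p j 0 (taylorList l r) with hsdef
  set v₀ := valFuel p (64 * (l.length + 1) * (j + 1)) (s.foldl (fun a b => (Int.gcd a b : ℤ)) 0)
    with hv₀
  rw [List.all_eq_true] at hall
  have hall' : ∀ c ∈ s, (p : ℤ) ^ v₀ ∣ c := fun c hc => by
    have := hall c hc
    rw [beq_iff_eq] at this
    exact Int.dvd_of_emod_eq_zero this
  have hq0 : ((p : ℤ) ^ v₀) ≠ 0 := pow_ne_zero _ (by exact_mod_cast hp.out.ne_zero)
  -- `z = r + p^j t'`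
  have hzr' := hzr
  rw [PadicInt.norm_le_pow_iff_mem_span_pow, Ideal.mem_span_singleton'] at hzr'
  obtain ⟨t', ht'⟩ := hzr'
  have hz : z = ((p : ℤ_[p]) ^ j * t') + (r : ℤ_[p]) := by rw [mul_comm, ht']; ring
  -- `Σ dᵢ t'ⁱ = 0` in `ℤ_p`
  have hG : aeval t' (ofList s) = 0 := by
    rw [hsdef, aeval_ofList_scaleList, pow_zero, one_mul, aeval_ofList_taylorList, ← hz, hz0]
  rw [ofList_eq_C_mul_of_all_dvd _ s hall', map_mul, aeval_C] at hG
  have hq0' : (algebraMap ℤ ℤ_[p]) ((p : ℤ) ^ v₀) ≠ 0 := by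
    rw [eq_intCast]; exact_mod_cast hq0
  have hD : aeval t' (ofList (s.map fun c => c / (p : ℤ) ^ v₀)) = 0 :=
    (mul_eq_zero.mp hG).resolve_left hq0'
  -- the digit: `t' ≡ t (mod p)`
  have htt : PadicInt.toZMod t' = ((t : ℤ) : ZMod p) := by
    have hdiff : ‖t' - (t : ℤ_[p])‖ < 1 := by
      have h1 : z - ((r + t * (p : ℤ) ^ j : ℤ) : ℤ_[p]) = (p : ℤ_[p]) ^ j * (t' - (t : ℤ_[p])) := by
        rw [hz]; push_cast; ring
      rw [h1, norm_mul, PadicInt.norm_p_pow] at hzt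
      have hpj : (0 : ℝ) < (p : ℝ) ^ (-(j : ℤ)) := zpow_pos (by exact_mod_cast hp.out.pos) _
      have h2 : ‖t' - (t : ℤ_[p])‖ ≤ (p : ℝ) ^ (-((j + 1 : ℕ) : ℤ)) / (p : ℝ) ^ (-(j : ℤ)) := by
        rw [le_div_iff₀ hpj, mul_comm]; exact hzt
      refine h2.trans_lt ?_
      rw [div_lt_one hpj]
      exact zpow_lt_zpow_right₀ (by exact_mod_cast hp.out.one_lt) (by push_cast; omega)
    have hker : t' - (t : ℤ_[p]) ∈ RingHom.ker (PadicInt.toZMod : ℤ_[p] →+* ZMod p) := by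
      rw [PadicInt.ker_toZMod, IsLocalRing.mem_maximalIdeal, PadicInt.mem_nonunits]; exact hdiff
    rw [RingHom.mem_ker, map_sub, sub_eq_zero, map_intCast] at hker
    exact hker
  -- reduce mod `p`
  have hZ := congrArg PadicInt.toZMod hD
  rw [map_aeval_ofList, map_zero, htt, aeval_intCast_zmod_ofList,
    ZMod.intCast_zmod_eq_zero_iff_dvd] at hZ
  have hmap : (s.map fun c => c / (p : ℤ) ^ v₀ % (p : ℤ)) =
      (s.map fun c => c / (p : ℤ) ^ v₀).map (fun c => c % (p : ℤ)) := by
    rw [List.map_map]; rfl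
  rw [← hs, hmap, Int.dvd_iff_emod_eq_zero, evalList_map_emod, ← Int.dvd_iff_emod_eq_zero]
  exact hZ

/-- **The digit of a root survives the sieve**: for a root `z` of `F` in the class of `r (mod p^j)`
with digit `t < p` at level `j`, `t ∈ childDigits p l j r`. [folklore] -/
theorem mem_childDigits_of_root {l : List ℤ} {j : ℕ} {r : ℤ} {z : ℤ_[p]}
    (hz0 : aeval z (ofList l) = 0) (hzr : ‖z - (r : ℤ_[p])‖ ≤ (p : ℝ) ^ (-(j : ℤ))) {t : ℕ}
    (htp : t < p)
    (hzt : ‖z - ((r + (t : ℤ) * (p : ℤ) ^ j : ℤ) : ℤ_[p])‖ ≤ (p : ℝ) ^ (-((j + 1 : ℕ) : ℤ))) :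
    t ∈ childDigits p l j r := by
  unfold childDigits
  split
  · exact List.mem_range.mpr htp
  · rename_i ds hs
    refine List.mem_filter.mpr ⟨List.mem_range.mpr htp, ?_⟩
    rw [beq_iff_eq]
    exact Int.emod_eq_zero_of_dvd (dvd_evalList_of_root hs hz0 hzr hzt)

/-! ### §4 Soundness of the deep exclusion test -/

/-- **Soundness of the deep exclusion test**: if `deadDeep p l j r` then `F = ofList l` has no root
`z` with `‖z − r‖ ≤ p^{-j}` (FILE A1b's `aeval_ne_zero_of_dead`, fuel renamed). [folklore] -/
theorem aeval_ne_zero_of_deadDeep {l : List ℤ} {j : ℕ} {r : ℤ} (h : deadDeep p l j r = true)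
    {z : ℤ_[p]} (hz : ‖z - (r : ℤ_[p])‖ ≤ (p : ℝ) ^ (-(j : ℤ))) : aeval z (ofList l) ≠ 0 := by
  unfold deadDeep at h
  split at h
  · simp at h
  · rename_i c₀ cs htl
    simp only [Bool.and_eq_true, decide_eq_true_eq, Bool.not_eq_true', beq_eq_false_iff_ne, ne_eq,
      emod_eq_zero_iff_dvd'] at h
    obtain ⟨⟨hc0, hndvd⟩, htail⟩ := h
    set e := valFuel p (64 * (l.length + 1)) c₀ with he
    rw [PadicInt.norm_le_pow_iff_mem_span_pow, Ideal.mem_span_singleton'] at hz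
    obtain ⟨t, ht⟩ := hz
    have hzr : z = ((p : ℤ_[p]) ^ j * t) + (r : ℤ_[p]) := by rw [mul_comm, ht]; ring
    rw [hzr, ← aeval_ofList_taylorList, htl, aeval_ofList_cons]
    have hc0n : ‖(c₀ : ℤ_[p])‖ = (p : ℝ) ^ (-(e : ℤ)) :=
      norm_intCast_eq_of_dvd_of_not_dvd (pow_valFuel_dvd p (64 * (l.length + 1)) c₀) hndvd
    have htailn := norm_pow_mul_aeval_le_of_tailOK (e := e) (j := j) t 1 cs htail
    rw [pow_one] at htailn
    have hlt :
        ‖((p : ℤ_[p]) ^ j * t) * aeval ((p : ℤ_[p]) ^ j * t) (ofList cs)‖ < ‖(c₀ : ℤ_[p])‖ := by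
      rw [hc0n]
      exact htailn.trans_lt (zpow_lt_zpow_right₀ (by exact_mod_cast hp.out.one_lt)
        (by push_cast; omega))
    intro h0
    have := PadicInt.norm_add_eq_max_of_ne hlt.ne'
    rw [h0, norm_zero] at this
    have hpos : (0 : ℝ) < ‖(c₀ : ℤ_[p])‖ := by
      rw [hc0n]; exact zpow_pos (by exact_mod_cast hp.out.pos) _
    have : ‖(c₀ : ℤ_[p])‖ ≤ 0 := by rw [this]; exact le_max_left _ _
    exact absurd this (not_le.mpr hpos)

/-! ### §5 Soundness of the v3 tree search and the census theorem -/

/-- What `alive₃ … = false` means for a residue carrying `F ≡ 0` and a root in its class: it is in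
a ball. -/
private theorem inBall_of_not_alive₃ {l : List ℤ} {cert : List (ℤ × ℕ × ℕ)} {j : ℕ} {r : ℤ}
    (hF : (p : ℤ) ^ j ∣ evalList l r) {z : ℤ_[p]} (hz0 : aeval z (ofList l) = 0)
    (hz : ‖z - (r : ℤ_[p])‖ ≤ (p : ℝ) ^ (-(j : ℤ))) (ha : alive₃ p l cert j r = false) :
    ∃ e ∈ cert, e.2.1 + 1 ≤ j ∧ (p : ℤ) ^ (e.2.1 + 1) ∣ r - e.1 := by
  have hnd : deadDeep p l j r = false := by
    by_contra hd
    rw [Bool.not_eq_false] at hd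
    exact aeval_ne_zero_of_deadDeep hd hz hz0
  simp only [alive₃, hnd, Bool.not_false, Bool.and_true, Bool.and_eq_false_imp, beq_iff_eq,
    emod_eq_zero_iff_dvd', Bool.not_eq_false', inBall, List.any_eq_true, Bool.and_eq_true,
    decide_eq_true_eq] at ha
  exact ha hF |>.imp fun e he => ⟨he.1, he.2.1, he.2.2⟩

/-- **Soundness of the v3 tree search** (FILE A1b's `inBall_of_coverTree₂` with the sieved children:
the digit of a root always survives the sieve, `mem_childDigits_of_root`). [folklore] -/
theorem inBall_of_coverTree₃ (l : List ℤ) (cert : List (ℤ × ℕ × ℕ)) :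
    ∀ (fuel j : ℕ) (fr : List ℤ), coverTree₃ p l cert fuel j fr = true →
      (∀ z : ℤ_[p], aeval z (ofList l) = 0 →
        (∀ e ∈ cert, ¬ ‖z - (e.1 : ℤ_[p])‖ ≤ (p : ℝ) ^ (-((e.2.1 + 1 : ℕ) : ℤ))) →
        ∃ r ∈ fr, ‖z - (r : ℤ_[p])‖ ≤ (p : ℝ) ^ (-(j : ℤ))) →
      ∀ z : ℤ_[p], aeval z (ofList l) = 0 →
        ∃ e ∈ cert, ‖z - (e.1 : ℤ_[p])‖ ≤ (p : ℝ) ^ (-((e.2.1 + 1 : ℕ) : ℤ)) := by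
  intro fuel
  induction fuel with
  | zero =>
    intro j fr h hinv z hz
    by_contra hne
    simp only [not_exists, not_and] at hne
    obtain ⟨r, hr, -⟩ := hinv z hz hne
    simp only [coverTree₃, List.isEmpty_iff] at h
    rw [h] at hr; exact absurd hr (by simp)
  | succ fuel ih =>
    intro j fr h hinv z hz
    by_contra hne
    simp only [not_exists, not_and] at hne
    simp only [coverTree₃, Bool.or_eq_true, List.isEmpty_iff] at h
    rcases h with h | h
    · obtain ⟨r, hr, -⟩ := hinv z hz hne
      rw [h] at hr; exact absurd hr (by simp)
    · suffices hinv' : ∀ z' : ℤ_[p], aeval z' (ofList l) = 0 →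
          (∀ e ∈ cert, ¬ ‖z' - (e.1 : ℤ_[p])‖ ≤ (p : ℝ) ^ (-((e.2.1 + 1 : ℕ) : ℤ))) →
          ∃ r ∈ frontierStep₃ p l cert j fr, ‖z' - (r : ℤ_[p])‖ ≤ (p : ℝ) ^ (-((j + 1 : ℕ) : ℤ)) by
        obtain ⟨e, he, hP⟩ := ih (j + 1) _ h (by exact_mod_cast hinv') z hz
        exact hne e he hP
      intro z' hz' hne'
      obtain ⟨r, hr, hzr⟩ := hinv z' hz' hne'
      obtain ⟨t, htp, hzt⟩ := exists_digit hzr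
      refine ⟨r + (t : ℤ) * (p : ℤ) ^ j, ?_, hzt⟩
      have hF : (p : ℤ) ^ (j + 1) ∣ evalList l (r + (t : ℤ) * (p : ℤ) ^ j) := by
        have h1 := padic_polynomial_dist (ofList l) (((r + (t : ℤ) * (p : ℤ) ^ j : ℤ)) : ℤ_[p]) z'
        rw [hz', sub_zero, aeval_intCast_ofList] at h1
        exact PadicInt.norm_int_le_pow_iff_dvd.mp
          (h1.trans (by rw [← norm_neg, neg_sub]; exact hzt))
      have halive : alive₃ p l cert (j + 1) (r + (t : ℤ) * (p : ℤ) ^ j) = true := by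
        by_contra ha
        rw [Bool.not_eq_true] at ha
        obtain ⟨e, he, hej, hdvd⟩ := inBall_of_not_alive₃ hF hz' hzt ha
        apply hne' e he
        have hp1 : (1 : ℝ) ≤ p := by exact_mod_cast hp.out.one_lt.le
        have hrc : ‖(((r + (t : ℤ) * (p : ℤ) ^ j : ℤ)) : ℤ_[p]) - (e.1 : ℤ_[p])‖ ≤
            (p : ℝ) ^ (-((e.2.1 + 1 : ℕ) : ℤ)) := by
          rw [← Int.cast_sub]; exact norm_intCast_le_of_dvd hdvd
        calc ‖z' - (e.1 : ℤ_[p])‖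
            = ‖(z' - (((r + (t : ℤ) * (p : ℤ) ^ j : ℤ)) : ℤ_[p])) +
                ((((r + (t : ℤ) * (p : ℤ) ^ j : ℤ)) : ℤ_[p]) - (e.1 : ℤ_[p]))‖ := by ring_nf
          _ ≤ max ‖z' - (((r + (t : ℤ) * (p : ℤ) ^ j : ℤ)) : ℤ_[p])‖
                ‖(((r + (t : ℤ) * (p : ℤ) ^ j : ℤ)) : ℤ_[p]) - (e.1 : ℤ_[p])‖ :=
              PadicInt.nonarchimedean _ _
          _ ≤ (p : ℝ) ^ (-((e.2.1 + 1 : ℕ) : ℤ)) :=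
              max_le (hzt.trans (zpow_le_zpow_right₀ hp1 (by push_cast; omega))) hrc
      exact List.mem_flatMap.mpr ⟨r, hr, List.mem_filter.mpr
        ⟨List.mem_map.mpr ⟨t, mem_childDigits_of_root hz' hzr htp hzt, rfl⟩, halive⟩⟩

/-- What `coverOK₃` certifies: every root of `F` in `ℤ_p` lies in a certified ball. [folklore] -/
theorem inBall_of_coverOK₃ {l : List ℤ} {k : ℕ} {cert : List (ℤ × ℕ × ℕ)}
    (h : coverOK₃ p l k cert = true) (z : ℤ_[p]) (hz : aeval z (ofList l) = 0) :
    ∃ e ∈ cert, ‖z - (e.1 : ℤ_[p])‖ ≤ (p : ℝ) ^ (-((e.2.1 + 1 : ℕ) : ℤ)) :=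
  inBall_of_coverTree₃ l cert k 0 [0] h
    (fun z _ _ => ⟨0, List.mem_singleton.mpr rfl, by simpa using PadicInt.norm_le_one z⟩) z hz

/-- **ROOT CENSUS for the v3 checker** (the shape of FILE A2's `exists_roots_of_check₂`): if
`check₃ p l k cert = true` then `F = ofList l` has EXACTLY `cert.length` roots in `ℤ_p`, pairwise
distinct, the `i`-th one in the certified ball of the `i`-th entry `(cᵢ, mᵢ, Nᵢ)` at distance
`< p^{-mᵢ}` and `≤ p^{-(Nᵢ - mᵢ)}` from `cᵢ`. [folklore] -/
theorem exists_roots_of_check₃ (l : List ℤ) (k : ℕ) (cert : List (ℤ × ℕ × ℕ))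
    (h : check₃ p l k cert = true) :
    ∃ ρ : Fin cert.length → ℤ_[p], Function.Injective ρ ∧
      (∀ i, aeval (ρ i) (ofList l) = 0 ∧
        ‖ρ i - ((cert.get i).1 : ℤ_[p])‖ < (p : ℝ) ^ (-((cert.get i).2.1 : ℤ)) ∧
        ‖ρ i - ((cert.get i).1 : ℤ_[p])‖ ≤
          (p : ℝ) ^ (-(((cert.get i).2.2 - (cert.get i).2.1 : ℕ) : ℤ))) ∧
      ∀ z : ℤ_[p], aeval z (ofList l) = 0 → ∃ i, ρ i = z := by
  simp only [check₃, Bool.and_eq_true, List.all_eq_true] at h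
  obtain ⟨⟨hent, hpw⟩, hcov⟩ := h
  exact exists_roots_of_cover l k cert hent hpw (inBall_of_coverOK₃ hcov)

/-- Sanity check of the kernel evaluation: `X² − 7` over `ℤ₃` (the two roots `≡ ±1 (mod 3)`).
[folklore] -/
example : check₃ 3 [-7, 0, 1] 1 [((1 : ℤ), 0, 1), (-1, 0, 1)] = true := by decide

end Summit.BirchSwinnertonDyer.Rank1Residual.Supersingular.RootCensusSieve
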